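import Summits.QuantumAdvantage.QuantumAdvantage.Theorems.SosSandwichPseudoBoundedAAClassicalCornerExponents
import Mathlib.Analysis.SpecialFunctions.Pow.Asymptotics
import HarnessLib

/-!
# Crux `PseudoBoundedAA` (stmt-QuantumAdvantage-15237, route SosSandwich) — the SINGLE-BOOLEAN-TREE sub-corner of the
# classical corner is SETTLED: a law `C·Var^a/T^b ≤ maxInf` holds for all total Boolean `f` with `D(f) ≤ T` iff `a ≥ 1 ∧ b ≥ 1`

Support file (`--supports stmt-QuantumAdvantage-15237`).  `Theorems/SosSandwichPseudoBoundedAAClassicalCornerExponents.lean`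
proved, on the sub-corner of the classical corner `R_T ⊆ K_T` consisting of (the `0/1` values of) single Boolean decision trees
of depth `≤ T`, that the law holds for `a ≥ 1 ∧ b ≥ 1` (OSSS, `C = 4`) and that `b ≥ 1` is necessary (tribes).  This file
adds the missing necessity `a ≥ 1` and packages the `iff`:

* §1 **`exists_and_calibrator`** — the AND function on `k` bits (tribes with ONE tribe, `Tribes_{k,1}`): one depth-`≤ k`
  tree, `Var = 2^{−k}(1 − 2^{−k}) ∈ [2^{−k}/2, 2^{−k}]`, every influence `≤ 2/2^k` (so `Inf ≈ 2·Var`: the `Var`-exponent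
  cannot drop below `1`);
* §2 **`and_defeats_subunit_var_exponent`** — the archimedean core: with `a < 1` the law on the AND calibrators would give
  `C·2^{δ(k+1)} ≤ 4·k^{b⁺}` (`δ = 1 − max(a,1/2) > 0`), contradicting `exp y / y^{b⁺} → ∞`
  (`tendsto_exp_div_rpow_atTop`);
* §3 **`booleanTreeCorner_law_only_if_var`** (law `⟹ a ≥ 1`) and **`booleanTreeCorner_law_iff`**:
  `(∃ C > 0, ∀ N T p t, T ≥ 1 → depth t ≤ T → p =_{cube} [t accepts] → Var[p] > 0 → ∃ i, C·Var[p]^a/T^b ≤ Infᵢ[p])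
   ↔ (1 ≤ a ∧ 1 ≤ b)` — O'Donnell–Saks–Schramm–Servedio's `maxInf ≥ Var/D(f)` is optimal in BOTH exponents among all real
  exponent pairs (AND for `a`, tribes for `b`).

Compare: on the symmetric sub-cone of `K` the region is `{a ≥ 2, b ≥ 2}` (`SymmetricCorner.symmetricCorner_law_iff`); on the
full classical corner `R_T` it lies between `{a ≥ 2, b ≥ 2}` and `{a ≥ 2, b ≥ 1}` (`classicalCorner_law_of_two_le`,
`classicalCorner_law_only_if`).  Honest label: calibration of a corner of an open conjecture; no registered stub, crux or summit
is closed.  Sources: O'Donnell–Saks–Schramm–Servedio FOCS 2005 Thm 1.1; O'Donnell 2014 §4.2, §8.6.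
-/

set_option linter.dupNamespace false

noncomputable section

namespace Summit.QuantumAdvantage.QuantumAdvantage.Theorems.SosSandwich

open Finset Function Filter
open Literature.Computability.Complexity Literature.Computability.QuantumComplexity

namespace ClassicalCornerCalibration

/-! ### §1 The AND calibrator (`Tribes_{k,1}`) -/

/-- **The AND calibrator.** For `k ≥ 1`, on `N = 1·k` bits the AND function (tribes with a single tribe) is a `{0,1}`-valued
polynomial of degree `≤ N` given by one decision tree of depth `≤ N`, with `2^{−k}/2 ≤ Var ≤ 2^{−k}` and every influence
`≤ 2/2^k`. [cite: ODonnell2014, §4.2] -/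
theorem exists_and_calibrator {k : ℕ} (hk : 1 ≤ k) :
    ∃ p : MvPolynomial (Fin (1 * k)) ℝ, p.totalDegree ≤ 1 * k ∧
      (∀ x, evalBool p x = 0 ∨ evalBool p x = 1) ∧
      (∃ (m : ℕ) (wt : Fin m → ℝ) (t : Fin m → DecisionTree (1 * k)),
        (∀ j, 0 ≤ wt j) ∧ ∑ j, wt j = 1 ∧ (∀ j, (t j).depth ≤ 1 * k) ∧
          ∀ x, evalBool p x = ∑ j, wt j * (if (t j).eval x = true then (1 : ℝ) else 0)) ∧
      1 / (2 * (2 : ℝ) ^ k) ≤ boolVariance p ∧ boolVariance p ≤ 1 / (2 : ℝ) ^ k ∧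
      ∀ i, influence i p ≤ 2 / (2 : ℝ) ^ k := by
  classical
  set f : (Fin (1 * k) → Bool) → Bool := fun x => tribes 1 k (fun q => x (finProdFinEquiv q)) with hf
  obtain ⟨p, hdeg, hp, hmix⟩ := exists_mixture_of_boolean f
  have h2k : (2 : ℝ) ≤ (2 : ℝ) ^ k := by
    calc (2 : ℝ) = 2 ^ 1 := by norm_num
      _ ≤ 2 ^ k := pow_le_pow_right₀ (by norm_num) hk
  have h2k0 : (0 : ℝ) < (2 : ℝ) ^ k := by positivity
  -- the count of ones is `1`
  have hcardT : (((Finset.univ.filter fun x => f x = true).card : ℕ) : ℝ) = 1 := by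
    have h := Finset.card_filter_add_card_filter_not
      (s := (Finset.univ : Finset (Fin (1 * k) → Bool))) (fun x => f x = true)
    have hF : ((Finset.univ : Finset (Fin (1 * k) → Bool)).filter (fun x => ¬ f x = true)).card = (2 ^ k - 1) ^ 1 := by
      rw [← card_filter_tribesFin_eq_false 1 k]
      congr 1; ext x
      simp only [Finset.mem_filter, Finset.mem_univ, true_and, Bool.not_eq_true, hf]
    rw [hF, Finset.card_univ, Fintype.card_fun, Fintype.card_bool, Fintype.card_fin, pow_one] at h
    have h1k : 2 ^ (1 * k) = 2 ^ k := by rw [Nat.one_mul]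
    rw [h1k] at h
    have h1 : 1 ≤ 2 ^ k := Nat.one_le_two_pow
    have : ((Finset.univ.filter fun x => f x = true).card : ℕ) = 1 := by omega
    rw [this, Nat.cast_one]
  have hN : (2 : ℝ) ^ (1 * k) = (2 : ℝ) ^ k := by rw [Nat.one_mul]
  have hvar : boolVariance p = 1 / (2 : ℝ) ^ k * (1 - 1 / (2 : ℝ) ^ k) := by
    rw [boolVariance_eq_of_boolean p f hp, hcardT, hN]
  refine ⟨p, hdeg, fun x => ?_, hmix, ?_, ?_, fun i => ?_⟩
  · rw [hp x]; cases f x <;> simp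
  · rw [hvar]
    have hhalf : 1 / (2 : ℝ) ≤ 1 - 1 / (2 : ℝ) ^ k := by
      have : 1 / (2 : ℝ) ^ k ≤ 1 / 2 := by
        rw [div_le_div_iff₀ h2k0 (by norm_num)]; linarith
      linarith
    calc 1 / (2 * (2 : ℝ) ^ k) = 1 / (2 : ℝ) ^ k * (1 / 2) := by ring
      _ ≤ 1 / (2 : ℝ) ^ k * (1 - 1 / (2 : ℝ) ^ k) := mul_le_mul_of_nonneg_left hhalf (by positivity)
  · rw [hvar]
    have h0 : 0 ≤ 1 / (2 : ℝ) ^ k := by positivity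
    have h1 : 1 - 1 / (2 : ℝ) ^ k ≤ 1 := by linarith
    calc 1 / (2 : ℝ) ^ k * (1 - 1 / (2 : ℝ) ^ k) ≤ 1 / (2 : ℝ) ^ k * 1 := mul_le_mul_of_nonneg_left h1 h0
      _ = 1 / (2 : ℝ) ^ k := mul_one _
  · have h2N : (0 : ℝ) < (2 : ℝ) ^ (1 * k) := by positivity
    rw [influence_eq_card_of_boolean p f hp i, hN, div_le_div_iff₀ h2k0 h2k0]
    have hle := card_filter_tribesFin_pivotal_le (s := 1) (w := k) i
    rw [Nat.sub_self, pow_zero, mul_one] at hle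
    have hle' : (((Finset.univ : Finset (Fin (1 * k) → Bool)).filter
        (fun x => f (update x i true) ≠ f (update x i false))).card : ℝ) ≤ 2 := by exact_mod_cast hle
    exact mul_le_mul_of_nonneg_right hle' h2k0.le

/-! ### §2 The archimedean core: AND defeats every `Var`-exponent below one -/

/-- **AND defeats every sub-unit `Var`-exponent.** There are no `C > 0`, real `b` and `a < 1` such that for every `k ≥ 1` some
polynomial `p` on `1·k` bits with `Var[p] ∈ [2^{−k}/2, 2^{−k}]` and all influences `≤ 2/2^k` (the AND calibrators) has a
variable with `C·Var[p]^a/k^b ≤ Infᵢ[p]`: this would give `C·e^{y} ≤ 4·(y/c)^{b⁺}` along `y = c(k+1) → ∞`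
(`c = (1 − max(a,1/2)) log 2 > 0`), against `e^y / y^{b⁺} → ∞`. [cite: ODonnell2014, §4.2] -/
theorem and_defeats_subunit_var_exponent {a b C : ℝ} (hC : 0 < C) (ha : a < 1)
    (h : ∀ k : ℕ, 1 ≤ k → ∃ p : MvPolynomial (Fin (1 * k)) ℝ,
      1 / (2 * (2 : ℝ) ^ k) ≤ boolVariance p ∧ boolVariance p ≤ 1 / (2 : ℝ) ^ k ∧
        (∀ i, influence i p ≤ 2 / (2 : ℝ) ^ k) ∧
        ∃ i, C * boolVariance p ^ a / (((1 * k : ℕ) : ℝ)) ^ b ≤ influence i p) : False := by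
  -- exponents
  set a' : ℝ := max a (1 / 2) with ha'
  have ha'1 : a' < 1 := max_lt ha (by norm_num)
  have haa' : a ≤ a' := le_max_left _ _
  have ha'0 : 0 < a' := lt_of_lt_of_le (by norm_num) (le_max_right _ _)
  set δ : ℝ := 1 - a' with hδ
  have hδ0 : 0 < δ := by rw [hδ]; linarith
  set b' : ℝ := max b 0 with hb'
  have hb'0 : 0 ≤ b' := le_max_right _ _
  have hbb' : b ≤ b' := le_max_left _ _
  have hlog : 0 < Real.log 2 := Real.log_pos one_lt_two
  set c : ℝ := δ * Real.log 2 with hc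
  have hc0 : 0 < c := mul_pos hδ0 hlog
  have hcb : 0 < c ^ b' := Real.rpow_pos_of_pos hc0 b'
  set M : ℝ := 4 / (C * c ^ b') with hM
  -- eventually `exp y / y^{b'} ≥ M + 1`
  have hev : ∀ᶠ y in atTop, M + 1 ≤ Real.exp y / y ^ b' :=
    (tendsto_exp_div_rpow_atTop b').eventually (eventually_ge_atTop (M + 1))
  obtain ⟨y₀, hy₀⟩ := Filter.eventually_atTop.mp hev
  obtain ⟨k₀, hk₀⟩ := exists_nat_gt (y₀ / c)
  set k : ℕ := k₀ + 1 with hkdef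
  have hk1 : 1 ≤ k := by omega
  have hkR : (k : ℝ) = k₀ + 1 := by rw [hkdef]; push_cast; ring
  set y : ℝ := c * ((k : ℝ) + 1) with hy
  have hk₀' : y₀ < (k₀ : ℝ) * c := (div_lt_iff₀ hc0).mp hk₀
  have hyy₀ : y₀ ≤ y := by
    rw [hy, hkR]
    nlinarith [hk₀', hc0]
  have hy0 : 0 < y := by rw [hy]; positivity
  have hMy : M + 1 ≤ Real.exp y / y ^ b' := hy₀ y hyy₀
  -- the calibrator at `k`
  obtain ⟨p, hVlo, hVhi, hinf, i, hi⟩ := h k hk1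
  set V := boolVariance p with hV
  have h2k : (0 : ℝ) < (2 : ℝ) ^ k := by positivity
  have hV0 : 0 < V := lt_of_lt_of_le (by positivity) hVlo
  have hV1 : V ≤ 1 := by
    refine hVhi.trans ?_
    rw [div_le_one h2k]
    exact one_le_pow₀ (by norm_num)
  set T : ℝ := ((1 * k : ℕ) : ℝ) with hT
  have hTk : T = k := by rw [hT, Nat.one_mul]
  have hk0 : (0 : ℝ) < k := by rw [hkR]; positivity
  have hT1 : 1 ≤ T := by rw [hTk]; exact_mod_cast hk1
  have hT0 : 0 < T := by linarith
  -- Step 1: `C V^{a'} / T^{b'} ≤ 2/2^k`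
  have hVa : V ^ a' ≤ V ^ a := Real.rpow_le_rpow_of_exponent_ge hV0 hV1 haa'
  have hTb : T ^ b ≤ T ^ b' := Real.rpow_le_rpow_of_exponent_le hT1 hbb'
  have hTb0 : 0 < T ^ b := Real.rpow_pos_of_pos hT0 b
  have hTb'0 : 0 < T ^ b' := Real.rpow_pos_of_pos hT0 b'
  have hVa'0 : 0 ≤ V ^ a' := (Real.rpow_pos_of_pos hV0 a').le
  have h1 : C * V ^ a' / T ^ b' ≤ 2 / (2 : ℝ) ^ k := by
    calc C * V ^ a' / T ^ b' ≤ C * V ^ a / T ^ b' :=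
          div_le_div_of_nonneg_right (mul_le_mul_of_nonneg_left hVa hC.le) hTb'0.le
      _ ≤ C * V ^ a / T ^ b :=
          div_le_div_of_nonneg_left (mul_nonneg hC.le (le_trans hVa'0 hVa)) hTb0 hTb
      _ ≤ influence i p := hi
      _ ≤ 2 / (2 : ℝ) ^ k := hinf i
  -- Step 2: `V^{a'} ≥ (1/Q)^{a'} = 1/Q^{a'}`, `Q = 2^{k+1}`
  set Q : ℝ := (2 : ℝ) ^ (k + 1) with hQ
  have hQ2 : Q = 2 * (2 : ℝ) ^ k := by rw [hQ, pow_succ]; ring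
  have hQ0 : 0 < Q := by positivity
  have hVQ : 1 / Q ≤ V := by rw [hQ2]; exact hVlo
  have hQa : 0 < Q ^ a' := Real.rpow_pos_of_pos hQ0 a'
  have hVa' : 1 / Q ^ a' ≤ V ^ a' := by
    have := Real.rpow_le_rpow (by positivity) hVQ ha'0.le
    rwa [Real.div_rpow zero_le_one hQ0.le, Real.one_rpow] at this
  -- Step 3: `C Q^{δ} ≤ 4 T^{b'}`
  have h2 : C * (1 / Q ^ a') / T ^ b' ≤ 4 / Q := by
    calc C * (1 / Q ^ a') / T ^ b' ≤ C * V ^ a' / T ^ b' :=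
          div_le_div_of_nonneg_right (mul_le_mul_of_nonneg_left hVa' hC.le) hTb'0.le
      _ ≤ 2 / (2 : ℝ) ^ k := h1
      _ = 4 / Q := by rw [hQ2]; field_simp; ring
  have hQδ' : Q ^ δ = Q / Q ^ a' := by
    rw [hδ, Real.rpow_sub hQ0, Real.rpow_one]
  have h3 : C * Q ^ δ ≤ 4 * T ^ b' := by
    rw [div_le_div_iff₀ hTb'0 hQ0] at h2
    -- `h2 : C * (1 / Q^{a'}) * Q ≤ 4 * T^{b'}`
    have : C * (1 / Q ^ a') * Q = C * Q ^ δ := by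
      rw [hQδ']
      field_simp
    linarith [this]
  -- Step 4: `T^{b'} ≤ (k+1)^{b'} = y^{b'}/c^{b'}` and `Q^{δ} = exp y`
  have hTb'le : T ^ b' ≤ y ^ b' / c ^ b' := by
    have hk1' : T ≤ (k : ℝ) + 1 := by rw [hTk]; linarith
    calc T ^ b' ≤ ((k : ℝ) + 1) ^ b' := Real.rpow_le_rpow hT0.le hk1' hb'0
      _ = (y / c) ^ b' := by rw [hy, mul_div_cancel_left₀ _ hc0.ne']
      _ = y ^ b' / c ^ b' := Real.div_rpow hy0.le hc0.le b'
  have hQδ : Q ^ δ = Real.exp y := by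
    rw [Real.rpow_def_of_pos hQ0, hQ, Real.log_pow, hy, hc]
    push_cast
    congr 1; ring
  -- Step 5: `exp y / y^{b'} ≤ M`, contradiction
  have hyb : 0 < y ^ b' := Real.rpow_pos_of_pos hy0 b'
  have h4 : C * Real.exp y ≤ 4 * (y ^ b' / c ^ b') := by
    rw [← hQδ]; exact h3.trans (by nlinarith [hTb'le])
  have h4' : C * Real.exp y * c ^ b' ≤ 4 * y ^ b' := by
    have := mul_le_mul_of_nonneg_right h4 hcb.le
    calc C * Real.exp y * c ^ b' ≤ 4 * (y ^ b' / c ^ b') * c ^ b' := this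
      _ = 4 * y ^ b' := by field_simp
  have h5 : Real.exp y / y ^ b' ≤ M := by
    rw [hM, div_le_div_iff₀ hyb (by positivity)]
    have hring : Real.exp y * (C * c ^ b') = C * Real.exp y * c ^ b' := by ring
    linarith [h4', hring]
  linarith

/-! ### §3 The single-Boolean-tree sub-corner: admissible exponents are exactly `{a ≥ 1, b ≥ 1}` -/

/-- **Necessity on single Boolean trees: `a ≥ 1`.** A law `C·Var^a/T^b ≤ maxInf` for all `0/1`-valued polynomials given by
one decision tree of depth `≤ T` forces `a ≥ 1` (AND calibrators: `Var ≈ 2^{−k}`, all `Inf ≤ 2/2^k ≈ 2·Var`).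
[cite: ODonnell2014, §4.2] [cite: OdonnellEtAl2005, Thm 1.1] -/
theorem booleanTreeCorner_law_only_if_var (a b : ℝ)
    (hlaw : ∃ C : ℝ, 0 < C ∧ ∀ (N T : ℕ) (p : MvPolynomial (Fin N) ℝ) (t : DecisionTree N), 1 ≤ T → t.depth ≤ T →
      (∀ x : Fin N → Bool, evalBool p x = if t.eval x = true then (1 : ℝ) else 0) →
      0 < boolVariance p → ∃ i : Fin N, C * boolVariance p ^ a / (T : ℝ) ^ b ≤ influence i p) :
    1 ≤ a := by
  obtain ⟨C, hC, h⟩ := hlaw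
  by_contra hlt
  push Not at hlt
  refine and_defeats_subunit_var_exponent (b := b) hC hlt fun k hk => ?_
  obtain ⟨p, -, h01, -, hVlo, hVhi, hinf⟩ := exists_and_calibrator hk
  have hpos : 1 ≤ 1 * k := by omega
  have hv : 0 < boolVariance p := lt_of_lt_of_le (by positivity) hVlo
  obtain ⟨t₁, ht₁, hd₁⟩ := DecisionTree.exists_computes_depth_le (fun x : Fin (1 * k) → Bool =>
    decide (evalBool p x = 1))
  have hp : ∀ x, evalBool p x = if t₁.eval x = true then (1 : ℝ) else 0 := by
    intro x
    rw [ht₁ x]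
    beta_reduce
    by_cases h1 : evalBool p x = 1
    · rw [decide_eq_true h1, if_pos rfl, h1]
    · rw [decide_eq_false h1, if_neg Bool.false_ne_true]
      exact (h01 x).resolve_right h1
  obtain ⟨i, hi⟩ := h (1 * k) (1 * k) p t₁ hpos hd₁ hp hv
  exact ⟨p, hVlo, hVhi, hinf, i, hi⟩

/-- **The single-Boolean-tree sub-corner is settled.**  For real `a, b`: "`∃ C > 0`, every polynomial taking on the cube the
`0/1` values of ONE decision tree of depth `≤ T` (`T ≥ 1`), with `Var > 0`, has a variable with `C·Var^a/T^b ≤ Infᵢ`" holds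
**iff `1 ≤ a ∧ 1 ≤ b`** (`←`: OSSS `4 Var ≤ D(f)·maxInf`; `→`: AND for `a`, tribes for `b`).  O'Donnell–Saks–Schramm–Servedio's
exponents are optimal among all real pairs. [cite: OdonnellEtAl2005, Thm 1.1] [cite: ODonnell2014, §4.2] -/
theorem booleanTreeCorner_law_iff (a b : ℝ) :
    (∃ C : ℝ, 0 < C ∧ ∀ (N T : ℕ) (p : MvPolynomial (Fin N) ℝ) (t : DecisionTree N), 1 ≤ T → t.depth ≤ T →
      (∀ x : Fin N → Bool, evalBool p x = if t.eval x = true then (1 : ℝ) else 0) →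
      0 < boolVariance p → ∃ i : Fin N, C * boolVariance p ^ a / (T : ℝ) ^ b ≤ influence i p) ↔
      (1 ≤ a ∧ 1 ≤ b) := by
  constructor
  · intro h
    exact ⟨booleanTreeCorner_law_only_if_var a b h, booleanTreeCorner_law_only_if a b h⟩
  · rintro ⟨ha, hb⟩
    exact booleanTreeCorner_law_of_one_le ha hb

end ClassicalCornerCalibration

end Summit.QuantumAdvantage.QuantumAdvantage.Theorems.SosSandwich

end
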